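import Summits.RiemannHypothesis.RiemannHypothesis.Theorems.SignConeConeMagnificationLandau

/-!
# Route SignCone, item `ExactConeRigidity` (stmt-RiemannHypothesis-16306): the one-sided Landau
transfer (surplus side, and either side)

The exact chain for `ExactConeRigidity` (exact sign-cone inequality at every cutoff ⇒ RH) is, after
duality and compactness (`SignConeExactConeRigidityCompact.lean`): ONE nonnegative weight `c` on `ℕ` is
exact-feasible against every Weil test; conclude RH. The 2001 route (archive fefr, Thm B; W-MAG Prop. 6.2)
ends in a LANDAU TRANSFER: once `D_c(s) - 1/(s-1)` (`D_c = Σ c(n) n^{-s}`) continues analytically to thin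
rectangles about every horizontal segment of `1/2 < Re s ≤ X` and ONE of the two sign-parts of `c - Λ` has a
Dirichlet series converging for all `Re s > 1/2`, the Riemann hypothesis follows. The DEFICIT side
(`Σ (Λ-c)₊ n^{-σ} < ∞`) is the tree's `SignCone.riemannHypothesis_of_fakeWeight_landau`
(`SignConeConeMagnificationLandau.lean`, route prover of `ConeMagnification`). This file adds

* `riemannHypothesis_of_fakeWeight_landau_surplus` — the SURPLUS side: `Σ (c-Λ)₊ n^{-σ} < ∞` for all
  `σ > 1/2` suffices as well. Proof: the deficit series `Σ (Λ-c)₊ n^{-s}` has nonnegative coefficients,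
  converges for `Re s > 1` (`(Λ-c)₊ ≤ Λ`), and equals `Σ (c-Λ)₊ n^{-s} - (D_c - 1/(s-1)) - ζ₁'/ζ₁` there
  (`LSeries_posPart_sub_vonMangoldt`), a function holomorphic on `{Re s > x₁} ∪ W₀`, `W₀` a thin rectangle
  about the real segment `(1/2, x₁ + 2)` (`ζ₁` has no real zero there); so by Landau's theorem for
  generalized Dirichlet series with nonnegative coefficients
  (`Landau.summable_of_differentiableOn_union_convex`) it converges for every `σ > 1/2` — which is the
  deficit hypothesis of `riemannHypothesis_of_fakeWeight_landau`;
* `riemannHypothesis_of_fakeWeight_landau_oneSided` — either side (archive fefr Thm B: "`c ∈ K` with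
  `Σ(Λ−c)₊ n^{−σ} < ∞` or `Σ(c−Λ)₊ n^{−σ} < ∞` forces RH"; the 16303 crux-idea card `landau-pinch`).

No route object enters; the continuation of `D_c` is an explicit hypothesis (for exact-cone and unit-slack
weights it is the translate-boundedness / Laplace-transform theorem).
-/

noncomputable section

-- `Summit.RiemannHypothesis.RiemannHypothesis.…` repeats a namespace component by design (D-0017 layout).
set_option linter.dupNamespace false

open Complex Filter Set Metric Topology LSeries
open scoped ArithmeticFunction.vonMangoldt

namespace Summit.RiemannHypothesis.RiemannHypothesis.Theorems.SignConeExactConeRigidity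

open Literature.NumberTheory.LFunctions
open Summit.RiemannHypothesis.RiemannHypothesis.Theorems.SignCone

/-- The deficit series `Σ (Λ-c)₊ n^{-s}` of a nonnegative weight converges absolutely for `Re s > 1`
(comparison `0 ≤ (Λ-c)₊ ≤ Λ`, `ArithmeticFunction.LSeriesSummable_vonMangoldt`). -/
theorem LSeriesSummable_posPart_vonMangoldt_sub {c : ℕ → ℝ} (hc : ∀ n, 0 ≤ c n) {s : ℂ} (hs : 1 < s.re) :
    LSeriesSummable (fun n => ((max (Λ n - c n) 0 : ℝ) : ℂ)) s := by
  refine Summable.of_norm_bounded (ArithmeticFunction.LSeriesSummable_vonMangoldt hs).norm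
    fun n => norm_term_le _ ?_
  rw [Complex.norm_real, Complex.norm_real, Real.norm_of_nonneg (le_max_right _ _),
    Real.norm_of_nonneg ArithmeticFunction.vonMangoldt_nonneg]
  exact max_le (by linarith [hc n]) ArithmeticFunction.vonMangoldt_nonneg

/-- **The Landau transfer, surplus side.** Let `c ≥ 0` be a weight on `ℕ` whose Dirichlet series
`D_c(s) = Σ c(n) n^{-s}` converges absolutely at some real `x₀` and such that

* (continuation) for every height `γ` and every `X`, `D_c(s) - 1/(s-1)` agrees, on the part of a thin open
  rectangle `(1/2, X) × (γ - δ, γ + δ)` where `Re s > x₀`, with a function holomorphic on the whole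
  rectangle;
* (surplus) `Σₙ (c(n) - Λ(n))₊ n^{-σ} < ∞` for every real `σ > 1/2`.

Then the Riemann hypothesis holds. The deficit series `Σ (Λ-c)₊ n^{-s}` (nonnegative coefficients,
convergent for `Re s > 1`) equals `Σ (c-Λ)₊ n^{-s} - (D_c(s) - 1/(s-1)) - ζ₁'(s)/ζ₁(s)` for `Re s > x₁`
(`LSeries_posPart_sub_vonMangoldt`), which is holomorphic on `{Re s > x₁} ∪ W₀`, `W₀` a thin rectangle about
the real segment `(1/2, x₁ + 2)` (no real zero of `ζ₁`, `TuranLiouville.exists_strip_riemannZeta₁_ne_zero`);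
by Landau (`Landau.summable_of_differentiableOn_union_convex`) it converges for all `σ > 1/2`, and
`riemannHypothesis_of_fakeWeight_landau` (deficit side) concludes. (Archive 2001 fefr Thm B; W-MAG Prop. 6.2.)
-/
theorem riemannHypothesis_of_fakeWeight_landau_surplus {c : ℕ → ℝ} (hc : ∀ n, 0 ≤ c n) {x₀ : ℝ}
    (hsum : LSeriesSummable (fun n => (c n : ℂ)) x₀)
    (hcont : ∀ γ X : ℝ, ∃ δ : ℝ, 0 < δ ∧ ∃ A : ℂ → ℂ,
      DifferentiableOn ℂ A (({s : ℂ | 1 / 2 < s.re} ∩ {s : ℂ | s.re < X}) ∩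
        ({s : ℂ | s.im < γ + δ} ∩ {s : ℂ | γ - δ < s.im})) ∧
      ∀ s ∈ (({s : ℂ | 1 / 2 < s.re} ∩ {s : ℂ | s.re < X}) ∩
        ({s : ℂ | s.im < γ + δ} ∩ {s : ℂ | γ - δ < s.im})), x₀ < s.re → s ≠ 1 →
        LSeries (fun n => (c n : ℂ)) s = A s + (s - 1)⁻¹)
    (hsur : ∀ σ : ℝ, 1 / 2 < σ → LSeriesSummable (fun n => ((max (c n - Λ n) 0 : ℝ) : ℂ)) σ) :
    RiemannHypothesis := by
  -- notation: `f = (c - Λ)₊` (known), `d = (Λ - c)₊` (to be controlled), the abscissa `x₁`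
  set f : ℕ → ℝ := fun n => max (c n - Λ n) 0 with hf
  set d : ℕ → ℝ := fun n => max (Λ n - c n) 0 with hd
  set x₁ : ℝ := max x₀ 2 with hx₁
  have hx₀₁ : x₀ ≤ x₁ := le_max_left _ _
  have h2x₁ : (2 : ℝ) ≤ x₁ := le_max_right _ _
  set V : Set ℂ := {s : ℂ | x₁ < s.re} with hV
  have hVo : IsOpen V := isOpen_lt continuous_const continuous_re
  -- summability and analyticity of the known series
  have hcs : ∀ s : ℂ, x₀ < s.re → LSeriesSummable (fun n => (c n : ℂ)) s := fun s hs =>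
    hsum.of_re_le_re (by rw [ofReal_re]; exact hs.le)
  have hfs : ∀ s : ℂ, 1 / 2 < s.re → LSeriesSummable (fun n => ((f n : ℝ) : ℂ)) s := fun s hs =>
    (hsur s.re hs).of_re_le_re (by rw [ofReal_re])
  have hds : ∀ s : ℂ, 1 < s.re → LSeriesSummable (fun n => ((d n : ℝ) : ℂ)) s := fun s hs =>
    LSeriesSummable_posPart_vonMangoldt_sub hc hs
  have habsc : abscissaOfAbsConv (fun n => (c n : ℂ)) ≤ x₀ := by
    have := hsum.abscissaOfAbsConv_le
    rwa [ofReal_re] at this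
  have habsf : abscissaOfAbsConv (fun n => ((f n : ℝ) : ℂ)) ≤ (1 / 2 : ℝ) :=
    abscissaOfAbsConv_le_of_forall_lt_LSeriesSummable fun y hy => hfs y (by rw [ofReal_re]; exact hy)
  have hBc : DifferentiableOn ℂ (fun s => LSeries (fun n => (c n : ℂ)) s - (s - 1)⁻¹) V := by
    intro s hs
    have hs' : x₁ < s.re := hs
    have hsa : abscissaOfAbsConv (fun n => (c n : ℂ)) < s.re :=
      habsc.trans_lt (by exact_mod_cast (hx₀₁.trans_lt hs'))
    have hs1 : s - 1 ≠ 0 := by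
      rw [sub_ne_zero]
      intro h
      rw [h, one_re] at hs'
      linarith
    exact ((LSeries_analyticOnNhd _ s hsa).differentiableAt.sub
      ((differentiableAt_id.sub_const 1).inv hs1)).differentiableWithinAt
  have hDf : DifferentiableOn ℂ (LSeries fun n => ((f n : ℝ) : ℂ)) {s : ℂ | 1 / 2 < s.re} := by
    intro s hs
    have hs' : 1 / 2 < s.re := hs
    have hsa : abscissaOfAbsConv (fun n => ((f n : ℝ) : ℂ)) < s.re :=
      habsf.trans_lt (by exact_mod_cast hs')
    exact (LSeries_analyticOnNhd _ s hsa).differentiableAt.differentiableWithinAt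
  -- `ζ₁ ≠ 0` on `Re s > 1` and on a thin strip about the real segment `[1/2, 5]`
  obtain ⟨δ₁, hδ₁, hfree⟩ := TuranLiouville.exists_strip_riemannZeta₁_ne_zero
  have hζ₁V : ∀ s : ℂ, 1 < s.re → riemannZeta₁ s ≠ 0 := fun s hs => (neg_deriv_riemannZeta_div_eq hs).1
  have hζ₁d : ∀ s : ℂ, riemannZeta₁ s ≠ 0 → DifferentiableAt ℂ (logDeriv riemannZeta₁) s := by
    intro s hs
    have h : logDeriv riemannZeta₁ = fun z ↦ deriv riemannZeta₁ z / riemannZeta₁ z := by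
      funext z; rw [logDeriv_apply]
    rw [h]
    exact (differentiable_riemannZeta₁.analyticAt s).deriv.differentiableAt.div
      (differentiable_riemannZeta₁ s) hs
  -- the identity `LSeries d = LSeries f - (D_c - 1/(s-1)) - ζ₁'/ζ₁` on `V`
  have hident : ∀ s ∈ V, LSeries (fun n => ((d n : ℝ) : ℂ)) s =
      LSeries (fun n => ((f n : ℝ) : ℂ)) s - (LSeries (fun n => (c n : ℂ)) s - (s - 1)⁻¹) -
        logDeriv riemannZeta₁ s := by
    intro s hs
    have hs' : x₁ < s.re := hs
    have h1 : 1 < s.re := by linarith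
    have h := LSeries_posPart_sub_vonMangoldt h1 (hcs s (by linarith)) (hds s h1)
    rw [h]
    ring
  -- the generalized-Dirichlet data of `d`
  set a : ℕ → ℝ := fun n => if n = 0 then 0 else d n with ha
  set ℓ : ℕ → ℝ := fun n => Real.log n with hℓ
  have ha0 : ∀ n, 0 ≤ a n := fun n => by
    simp only [ha]
    split_ifs
    · exact le_rfl
    · exact le_max_right _ _
  have hℓ0 : ∀ n, 0 ≤ ℓ n := fun n => Real.log_natCast_nonneg n
  have hLd : ∀ s : ℂ, LSeries (fun n => ((d n : ℝ) : ℂ)) s = Landau.genDirichlet a ℓ s := fun s =>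
    Landau.LSeries_eq_genDirichlet d s
  have hSd : ∀ σ : ℝ, LSeriesSummable (fun n => ((d n : ℝ) : ℂ)) σ ↔
      Summable fun n : ℕ => a n * Real.exp (-(ℓ n * σ)) := fun σ =>
    Landau.LSeriesSummable_ofReal_iff d σ
  -- `LSeries d` converges absolutely at `x₁ > 1`
  have h₁ : Summable fun n : ℕ => a n * Real.exp (-(ℓ n * x₁)) :=
    (hSd x₁).1 (hds x₁ (by rw [ofReal_re]; linarith))
  -- Landau along the real axis, `W₀` a thin rectangle about `(1/2, x₁ + 2)`
  obtain ⟨δ₀, hδ₀, A₀, hA₀, hA₀eq⟩ := hcont 0 (x₁ + 2)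
  set δ : ℝ := min δ₀ δ₁ with hδ
  have hδp : 0 < δ := lt_min hδ₀ hδ₁
  set W₀ : Set ℂ := ({s : ℂ | 1 / 2 < s.re} ∩ {s : ℂ | s.re < x₁ + 2}) ∩
    ({s : ℂ | s.im < 0 + δ} ∩ {s : ℂ | 0 - δ < s.im}) with hW₀
  have hW₀oc := isOpen_convex_rect (x₁ + 2) 0 δ
  have hW₀sub : W₀ ⊆ ({s : ℂ | 1 / 2 < s.re} ∩ {s : ℂ | s.re < x₁ + 2}) ∩
      ({s : ℂ | s.im < 0 + δ₀} ∩ {s : ℂ | 0 - δ₀ < s.im}) := by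
    rintro s ⟨⟨h1, h2⟩, h3, h4⟩
    have h3' : s.im < 0 + δ := h3
    have h4' : 0 - δ < s.im := h4
    refine ⟨⟨h1, h2⟩, ?_, ?_⟩
    · show s.im < 0 + δ₀; linarith [min_le_left δ₀ δ₁]
    · show 0 - δ₀ < s.im; linarith [min_le_left δ₀ δ₁]
  have hW₀r : ∀ σ : ℝ, 1 / 2 < σ → σ ≤ x₁ + 1 → (σ : ℂ) ∈ W₀ := fun σ h1 h2 => by
    refine ⟨⟨?_, ?_⟩, ?_, ?_⟩ <;> simp only [mem_setOf_eq, ofReal_re, ofReal_im] <;> linarith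
  have hζ₁W₀ : ∀ s ∈ W₀, riemannZeta₁ s ≠ 0 := by
    rintro s ⟨⟨h1, h2⟩, h3, h4⟩
    have h1' : 1 / 2 < s.re := h1
    have h3' : s.im < 0 + δ := h3
    have h4' : 0 - δ < s.im := h4
    rcases le_or_gt s.re 5 with h5 | h5
    · exact hfree s h1'.le h5 (abs_lt.2 ⟨by linarith [min_le_right δ₀ δ₁], by linarith [min_le_right δ₀ δ₁]⟩)
    · exact hζ₁V s (by linarith)
  obtain ⟨hG₀d, hG₀B, hG₀A⟩ := differentiableOn_glue (x₁ := x₁) hW₀oc.1 hBc (hA₀.mono hW₀sub)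
    (fun s hs hsx => by
      have hs1 : s ≠ 1 := by
        intro h; have := congrArg Complex.re h; rw [one_re] at this; linarith
      have := hA₀eq s (hW₀sub hs) (by linarith) hs1
      rw [this]; ring)
  set Φ₀ : ℂ → ℂ := fun s => LSeries (fun n => ((f n : ℝ) : ℂ)) s -
    (if x₁ < s.re then LSeries (fun n => (c n : ℂ)) s - (s - 1)⁻¹ else A₀ s) -
    logDeriv riemannZeta₁ s with hΦ₀
  have hsub₀ : V ∪ W₀ ⊆ {s : ℂ | 1 / 2 < s.re} := by
    rintro s (hs | ⟨⟨hs, _⟩, _⟩)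
    · show 1 / 2 < s.re
      have : x₁ < s.re := hs
      linarith
    · exact hs
  have hΦ₀d : DifferentiableOn ℂ Φ₀ (V ∪ W₀) := by
    refine ((hDf.mono hsub₀).sub hG₀d).sub fun s hs => (hζ₁d s ?_).differentiableWithinAt
    rcases hs with hs | hs
    · exact hζ₁V s (by have : x₁ < s.re := hs; linarith)
    · exact hζ₁W₀ s hs
  have hagree₀ : EqOn Φ₀ (Landau.genDirichlet a ℓ) V := by
    intro s hs
    rw [← hLd s, hident s hs]
    simp only [hΦ₀, hG₀B hs]
  have hdef : ∀ σ : ℝ, 1 / 2 < σ → LSeriesSummable (fun n => ((d n : ℝ) : ℂ)) σ := fun σ hσ =>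
    (hSd σ).2 (Landau.summable_of_differentiableOn_union_convex ha0 hℓ0 h₁
      (by linarith : (1 / 2 : ℝ) < x₁) hW₀oc.1 hW₀oc.2 hW₀r hΦ₀d hagree₀ hσ)
  -- the deficit side concludes
  exact riemannHypothesis_of_fakeWeight_landau hc hsum hcont hdef

/-- **The Landau transfer, either side** (archive 2001 fefr Thm B: a cone weight with `Σ (Λ-c)₊ n^{-σ} < ∞`
OR `Σ (c-Λ)₊ n^{-σ} < ∞` for all `σ > 1/2` forces RH; crux-idea card `landau-pinch` of stmt-16303).
Hypotheses as in `riemannHypothesis_of_fakeWeight_landau` / `…_surplus`, with the one-sided summability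
as a disjunction. -/
theorem riemannHypothesis_of_fakeWeight_landau_oneSided {c : ℕ → ℝ} (hc : ∀ n, 0 ≤ c n) {x₀ : ℝ}
    (hsum : LSeriesSummable (fun n => (c n : ℂ)) x₀)
    (hcont : ∀ γ X : ℝ, ∃ δ : ℝ, 0 < δ ∧ ∃ A : ℂ → ℂ,
      DifferentiableOn ℂ A (({s : ℂ | 1 / 2 < s.re} ∩ {s : ℂ | s.re < X}) ∩
        ({s : ℂ | s.im < γ + δ} ∩ {s : ℂ | γ - δ < s.im})) ∧
      ∀ s ∈ (({s : ℂ | 1 / 2 < s.re} ∩ {s : ℂ | s.re < X}) ∩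
        ({s : ℂ | s.im < γ + δ} ∩ {s : ℂ | γ - δ < s.im})), x₀ < s.re → s ≠ 1 →
        LSeries (fun n => (c n : ℂ)) s = A s + (s - 1)⁻¹)
    (hone : (∀ σ : ℝ, 1 / 2 < σ → LSeriesSummable (fun n => ((max (Λ n - c n) 0 : ℝ) : ℂ)) σ) ∨
      (∀ σ : ℝ, 1 / 2 < σ → LSeriesSummable (fun n => ((max (c n - Λ n) 0 : ℝ) : ℂ)) σ)) :
    RiemannHypothesis := by
  rcases hone with hdef | hsur
  · exact riemannHypothesis_of_fakeWeight_landau hc hsum hcont hdef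
  · exact riemannHypothesis_of_fakeWeight_landau_surplus hc hsum hcont hsur

end Summit.RiemannHypothesis.RiemannHypothesis.Theorems.SignConeExactConeRigidity
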